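import Literature.MathematicalPhysics.QuantumFieldTheory.Balaban1983to89.B10Eq71TorusLocal
import Literature.MathematicalPhysics.QuantumFieldTheory.Balaban1983to89.B10Eq69Local
import Literature.MathematicalPhysics.QuantumFieldTheory.Balaban1983to89.B7TranslationCovariance
import Literature.MathematicalPhysics.QuantumFieldTheory.Balaban1983to89.B10Eq44AvgRegularity

/-!
# `Balaban1983to89.B10Eq69TorusPullback` — [Balaban1985UV3] p. 273 **(69) ON THE TORUS CARRIER OF RECORD `T_η = Setup.Site P 0`
# FOR PRINT'S OWN AVERAGING**: the concrete `j`-fold average (42)–(43) of [4] = [Balaban1985Averaging] of a `U(N)`-valued torus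
# configuration, read through the PERIODIC PULLBACK to `ℤ^d`; «Applying the inequalities (50), (53) [4], we have (69)» on the
# torus; and Sect. D's small factor (67)–(71) for one large-field plaquette with the hypothesis (69) of `B10Eq71TorusLocal` DISCHARGED

T. Bałaban, *Ultraviolet stability of three-dimensional lattice pure gauge field theories*, Commun. Math. Phys. **102**, 255–275
(1985) [Balaban1985UV3] (cell paper B10; held `paper:balaban1985-cmp102-uv-stability-3d`, journal page = PDF page + 254; p. 273 =
[PDF 19] re-read 2026-08-24 for this file on the text layer `p0019.txt`; p. 267 = [PDF 13] on `p0013.txt`).  «[4]» = T. Bałaban, *Averaging operations for lattice gauge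
theories*, Commun. Math. Phys. **98**, 17–51 (1985) [Balaban1985Averaging] (cell paper B7; held `paper:balaban1985-cmp98-averaging`,
journal page = PDF page + 16; p. 24 = [PDF 8], p. 26 = [PDF 10] re-read on `p0008.txt`, `p0010.txt`).  «…» = verbatim.

HONEST FRAMING (mega-formalization `lit-balaban`, verbatim): statement-level skeleton of published theorems with citation tags; proofs
where landed; nothing here is a claim about the Yang–Mills mass gap.

## The printed text

[Balaban1985UV3] p. 273: «Let us take a plaquette p′ ⊂ Λ_j and such that |V_j(∂p′) − 1| ≥ g_jp(g_j). We have  Ū_k^j = V_j on Λ_j, (67)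
and the configuration U_k satisfies the following regularity condition on B^j(Λ_j).  |U_k(∂p) − 1| < O(1)g_jp(q_j)L^{−2j} ⟦sic: p(g_j)⟧.
(68)  Applying the inequalities (50), (53) [4], we have  |Ū_k^j(∂p′) − 1| < Σ_{x∈B^j(x₀)} L^{−3j} Σ_{p⊂(p′)_x} |U_k(∂p) − 1| +
O(1)(g_jp(g_j))², (69)  where p′ = ⟨x₀, y₀, z₀, w₀⟩, (p′)_x denotes the plaquette p′ transported parallelly to the point x, i.e. the
lower left corner coincides with the point x. … Thus the part of the action 1/g_k²A^η(U_k) localized to the sum of four j-blocks Δ′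
connected with the plaquette p′ can be bounded from below by 1/4p²(g_j), and the corresponding part of the exponential gives the small
factor exp(−1/4p²(g_j)).»  [4] p. 24 (after (43)): «Let us notice that this definition is local in the sense that Ū^k_c, c ⊂ Ω^{(k)},
depends only on the bond variables U_b for b ⊂ B^k(c₋) ∪ B^k(c₊).»  [4] p. 26: «Proposition 2. If U satisfies (52) with α₀ ≦ c₂ =
min{1/(3C₀), ½c₂′}, then |Ū^k(∂p) − 1| < α₀ + 2C₀α₀² < 2α₀, p ⊂ Ω^{(k)}. (54)  The result is local in the sense that if p = ⟨x, y,
z, w⟩, then it is enough to assume (52) for p ⊂ B^k(x) ∪ B^k(y) ∪ B^k(z) ∪ B^k(w).»  [4] p. 19: «Ω^{(j)} may be replaced by any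
other lattice».

## Why this file exists (unit `lit-balaban-r07`, reader/typer and fold owner of B10; gen 57; row B10.Eq69 member, B10.Eq70/Eq71 riders)

The tree certifies (69) for the CONCRETE average (42)–(43) of [4] on the model lattice `ℤ^d` (`B10Eq69Concrete.eq69_at`, p29) and, with
the PRINTED LOCALITY of (68), `B10Eq69Local.eq69_local` (p29: (68) only on the unit plaquettes inside `Δ′`, through the clamped
extension of `B7Prop1Local`).  On print's carrier — the torus `T_η` — `B10Eq71TorusLocal` (this unit, gen 56) proves (70) ⇒ (71) and
the knit «for all plaquettes in all large fields set P» but takes (69) there as the hypothesis `h69` for the cell's axiomatised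
averaging `Setup.Averaging.iter` (its HONEST SCOPE (i): «a torus (69) from (50), (53) of [4] is NOT derived here»).  THIS FILE DERIVES
(69) ON THE TORUS FOR PRINT'S OWN AVERAGING: the `j`-fold average (43) of the periodic pullback `B10Eq27TorusAxialLog.pull` (this unit,
gen 54: `V♯_y(z, z + e_μ) = V(y + z, y + z + e_μ)`) of the torus configuration, read back on `T^{(j)}` — print's «Ω^{(j)} may be
replaced by any other lattice» ([4] p. 19) made literal by the locality of (43) ([4] p. 24) and its translation covariance
(`B7TranslationCovariance.avgIter_shiftCfg`, r20).

* §1 `pull_transl` (`V♯_{y+v} = t_v V♯_y`), `fine_shift` (the base corner of the block of `c + e_μ` is the base corner of the block of `c`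
  translated by `L^j e_μ`, wrap-around included since `L^j · sitesPerDir j = sitesPerDir 0`), **`avgT j U`** — THE `j`-FOLD AVERAGE
  `Ū^j` OF (43) OF THE TORUS CONFIGURATION `U` AS A CONFIGURATION ON `T^{(j)}` with values in `M_N(ℂ)ˣ`: at the bond `c = ⟨c₋, c₋ + e_κ⟩`
  of `T^{(j)}` it is `B7Prop2Explicit.avgIter L (V♯_{x(c₋)}) j` at the coarse bond `(0, κ)`, `x(c₋) = B5Ineq137Torus.fine P j c₋` the
  base corner of the block `B^j(c₋)` — and **`holT_avgT_plaqWord`**: `Ū^j(∂p′)` on the torus (`B10Eq27TorusAxialLog.holT` of `avgT`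
  around `p′`) IS the `ℤ^d` plaquette variable `hol (avgIter L V♯_{x₀} j) 0 (plaqWord μ ν)` of the average of the pullback based at the
  block corner `x₀♭` of `p′` (the four bonds of `p′` are read from three base points; translation covariance of (43) reconciles them,
  `avgT_shift`); `h67_of_bonds` — (67) plaquette-wise from (67) «Ū_k^j = V_j» on the four bonds of `p′`;
* §2 **`deltaAllT j p′`** — the fine plaquettes `p ⊂ Δ′ = B^j(x₀) ∪ B^j(y₀) ∪ B^j(z₀) ∪ B^j(w₀)` OF ALL ORIENTATIONS (lower-left and
  upper-right corner with `j`-block among the four corners of `p′`; for `p′ ⊂ Λ_j` these are plaquettes of `B^j(Λ_j)`, print's locus of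
  (68)); `mem_deltaAllT_of_plaqIn` (the `ℤ^d` box `[0, (L^j − 1)𝟙 + L^j(e_μ + e_ν)]` of `B7Prop1Local.loK/plaqHiK` at `z = 0` maps into
  it: `B10Eq71TorusLocal.plaqAt_mem_deltaT` + `transl_add_e`), `plaqAt_corner_mem_deltaAllT` (the sub-plaquettes of the translates
  `(p′)_x`); **`blockSum_dev_pull_eq_blockSumT`** — the (69) sum of the pullback (`B10Eq70Squaring.blockSum … (dev V♯_{x₀} μ ν)`) IS the
  torus (69) sum `B10Eq71TorusLocal.blockSumT j p′ (dist1 ∘ plaqHol U)` (`hol_pull`, `norm_holT_unitsField_plaqWord_sub_one`, gen 54);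
  `pdevOn_pull_le` — (68) on `deltaAllT j p′` gives the local (52)/(68) of `B7Prop1Local.pdevOn` for the pullback, both orientations
  (`h13_unitsField`, gen 54);
* §3 **`eq69_torus`** (general `d`): for a `U(N)`-valued configuration `U` on `T_η`, `p′` a plaquette of `T^{(j)}` (`j ≤ m + K`), (68) in
  the form «`dist1 (plaqHol U q) ≤ θ` on `deltaAllT j p′`, `θ < α₀L^{−2j}`» with the Prop.-2 smallness of [4] (`0 < α₀`, `C₀α₀ ≤ ⅓`,
  `2α₀ ≤ c₂′(d, L)`):  **`‖Ū^j(∂p′) − 1‖ ≤ Σ_{x∈B^j(x₀)} L^{−dj} Σ_{p⊂(p′)_x} |U(∂p) − 1| + (16/3)C₀α₀²`** — `B10Eq69Local.eq69_local`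
  (BY NAME) for the pullback based at `x₀♭`, at the coarse plaquette `(0; μ, ν)`, its two sides identified by §1–§2;
* §4 `d = 3`: **`smallFactor_of_largeField_torus_concrete`** — Sect. D's (67)–(71) for ONE large-field plaquette on the torus with (69)
  DISCHARGED for print's averaging: hypotheses (67) `Ū^j(∂p′) = V_j(∂p′)` (in `M_N(ℂ)`), the large-field condition
  `g_jp(g_j) ≤ |V_j(∂p′) − 1|`, (68) `|U(∂q) − 1| ≤ C₁g_jp(g_j)L^{−2j}` on `deltaAllT j p′`, `g_k² = g_j²L^{k−j}`, and «g_j sufficiently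
  small» explicit (`0 < g_jp ≤ 1`, the Prop.-2 smallness for `α₀ = 2C₁g_jp`, `½(2C₁C₂ + C₂²)g_jp ≤ ¼` with `C₂ = (64/3)C₀C₁²`) ⇒
  **`¼p²(g_j) ≤ (N/g_k²)·L^k·Σ_{q∈Δ′(p′)}[1 − Re tr U(∂q)]`** ((70) = `B10Eq71TorusLocal.sq_le_of_le69_torus_d3`, (71) =
  `B10Eq70Squaring.ineq71`, (11) = `B10Eq71TorusLocal.dist1_sq_le_unitaryGroup`, all BY NAME), `exp_localized_le_torus_concrete` (the
  factor `exp(−¼p²(g_j))`); `…_specialUnitaryGroup` — the same for the semi-simple model `SU(N)` of Theorem 1 through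
  `B10Eq27TorusAxialLog.toUField` (`reTr_suIncl`); `eq69_torus_shape` — (69) with the remainder packaged as `0 ≤ b ≤ (16/3)C₀α₀²`;
* §5 **`quarter_sum_le_wilsonAction_concrete`** (`U(N)`) / `…_specialUnitaryGroup` (`SU(N)`): «We get these small factors for all
  plaquettes in all large fields set P» against the full action `(1/g_k²)A^η(U_k)` (`Setup.wilsonAction (L^k) U`) on the torus with BOTH
  `h71` (gen 55) AND `h69` (gen 56) gone — `B10Eq71TorusOverlap.quarter_sum_le_of_local71_torus` BY NAME fed with §4:
  **`¼·Σ_{j∈J} Σ_{p′∈S′_j} ¼p_j² ≤ (N/g_k²)·A^η(U_k)`**, the remaining per-plaquette inputs being the printed (67), large field, (68).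
* §6 the same transport for the two other places where B10 applies [4]'s Prop. 2 to `Ū_k^j` on the torus: **`prop2_level_torus`** — [4]
  (53)–(54) at level `j ≤ k` with the printed locality, `‖Ū^j(∂p′) − 1‖ < 2α₀(L^jη)²` under (52) `dist1 (plaqHol U q) ≤ θ < α₀η²` on
  `deltaAllT j p′` (p29's `B10Eq44AvgRegularity.avg_level_lt_two_local` BY NAME); **`reg44_avg_torus`** / `…_specialUnitaryGroup` — the
  p. 267 sentence before (44) «|U_k(∂p) − 1| < 2L²B₃g_{k−1}p(g_{k−1})η² … implies … |Ū_k^j(∂p′) − 1| < 4L²B₃g_{k−1}p(g_{k−1})(L^jη)² for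
  p′ ⊂ Ω_k^{(j)}» ON THE TORUS for print's averaging (p29's `reg44_avg_unitaryGroup` BY NAME; a member of row B10.Eq44 on the carrier of
  record).

DICTIONARY print ↦ Lean (as in `B10Eq71TorusLocal`, plus): `Ū_k^j` (the `j`-fold average (43) of [4] of `U_k`) ↦ `avgT j U`
(bond variables in `M_N(ℂ)ˣ`), `Ū_k^j(∂p′)` ↦ `holT (avgT j U) p′.src (plaqWord p′.μ p′.ν)`; `U_k` on `T_η` ↦
`U : GaugeField P 0 (Matrix.unitaryGroup (Fin N) ℂ)` read in `M_N(ℂ)ˣ` by `unitsField` (gen 54); `|·|` ↦ the operator norm (19) of [4]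
(`Matrix.Norms.L2Operator`; the cell's `dist1`); `p ⊂ Δ′` (all orientations) ↦ `q ∈ deltaAllT j p′`; the `ℤ^d` side: `V♯_y = pull V y`,
level-`j` lattice `≅ ℤ^d` with the coarse plaquette `(0; μ, ν)` at the origin of the pullback based at `x₀♭ = fine P j p′.src`.

HONEST SCOPE.  (i) `Ū^j` is [4]'s (42)–(43) — the `exp[Σ L^{−d} log …]`-average with the straight contours of B5/B7 (`B7Prop1Explicit.bavg`,
`B7Prop2Explicit.avgIter`), i.e. print's own «(50), (53) [4]»; it is NOT an inhabitant of the cell's `Setup.Averaging` interface (its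
values lie in `M_N(ℂ)ˣ`; they are unitary where (52) holds, [4] (22)–(23) / `B7Prop2Explicit.bavg_mem_unitaryUnits`, which (69) does not
need), and nothing is asserted about the cell's other averaging inhabitants (`BlockAveraging.blockAvg`, the symmetric (0.4) of
[Balaban1987RG1]).  (ii) (69) is obtained with `≤` for the printed `<` and with every `O(1)` explicit (`C₀ = 14464(d+1)²(d+4)²`,
`c₂′ = 1/(512(d+1)(d+4)L²)` of `B7Prop1Explicit`/`B7Prop2Explicit`; remainder `(16/3)C₀α₀²`), exactly as on `ℤ^d` (p29).  (iii) (68) is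
assumed, non-strict as typed in the cell, on the fine plaquettes CONTAINED in `Δ′(p′)` (all four corners in the four corner blocks) — a
subset of print's «on B^j(Λ_j)» for `p′ ⊂ Λ_j`; (67) and the large-field condition stay hypotheses (they are the decomposition (7)/(40)
and [7] = B11).  (iv) `d = P.d` is free in §§1–3; `d = 3` where the printed exponents are displayed (§§4–5).  (v) Nothing of
[Balaban1985UV3] or [4] beyond the quoted passages is asserted; `B10Eq69Local` / `B10Eq44AvgRegularity` (p29), `B10Eq27TorusAxialLog` (gen 54), `B10Eq71TorusLocal`
/ `B10Eq71TorusOverlap` (gen 55–56), `B10Eq70Squaring`, `B7TranslationCovariance` (r20), `B7Prop1Local`, `B5Ineq137Torus` are used BY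
NAME, byte-identical.

WHAT THIS FILE PROVES (kernel, no `sorry`, no named facts, no structures; definitions with bodies `avgT`, `deltaAllT`; theorems
otherwise; axioms standard).  Value = row B10.Eq69 gains its member «(69) for print's averaging ON THE CARRIER OF RECORD», row B10.Eq44 the
p. 267 regularity sentence on the same carrier, and the gen-55/56 torus knit loses its last non-printed per-plaquette hypothesis `h69`;
NOT summit progress.
-/

noncomputable section

open scoped BigOperators

namespace Literature.MathematicalPhysics.QuantumFieldTheory.Balaban1983to89.B10Eq69TorusPullback

open B7Prop1Explicit renaming Site → LSite
open B7Prop1Explicit (e e_apply hol plaqWord boxVec U1)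
open B7Prop2Explicit (avgIter unitaryUnits unitaryUnits_le_U1 avgClosed_unitaryUnits C0 c2' C0_pos hol_plaqWord_self)
open B7Prop1Local (InBox PlaqIn pdevOn loK plaqHiK)
open B12Ineq417Flat (shiftCfg shiftCfg_apply)
open B7TranslationCovariance (avgIter_shiftCfg)
open B10Eq27TorusAxialLog (transl transl_apply transl_zero transl_add transl_add_e pull pull_apply holT holT_plaqWord
  hol_pull hol_pull_zero holT_plaqWord_eq_plaqHol unitsField val_unitsField unitsField_mem_unitaryUnits val_holT_unitsField
  norm_holT_unitsField_plaqWord_sub_one h13_unitsField toUField plaqHol_toUField dist1_plaqHol_toUField suIncl val_suIncl)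
open B10Eq70Squaring (Idx corner deltaBox mem_deltaBox blockSum dev ineq71)
open B10Eq71TorusOverlap (cornersJ deltaT mem_deltaT_iff)
open B10Eq71TorusLocal (plaqAt plaqAt_src pullFn pullFn_apply blockSumT plaqAt_mem_deltaT sq_le_of_le69_torus_d3
  dist1_sq_le_unitaryGroup dist1_sq_le_specialUnitaryGroup)
open B10Eq38TorusDomains (plaqsIn)
open B14.Eq22Determines (blockIter)
open B5Ineq137Torus (fine fine_val pow_mul_sitesPerDir)

variable {P : Params}

/-! ## §1 The pullback under translation of the base point, the base corners of neighbouring blocks, and `Ū^j` on the torus -/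

section Dictionary

variable {j : ℕ} {G : Type*}

/-- **`V♯_{y+v} = t_v V♯_y`**: the pullback based at the translate `y + v` is the translate by `v` (`B12Ineq417Flat.shiftCfg`,
`(t_vF)(z) = F(z + v)`) of the pullback based at `y`. (bookkeeping of the parallel transport (9) of [4] on the periodic lattice, no
content of the series) [cite: Balaban1985Averaging, (9) p.18, p.19 («Ω^{(j)} may be replaced by any other lattice»)] -/
theorem pull_transl (V : GaugeField P j G) (y : Site P j) (v : LSite P.d) :
    pull V (transl y v) = shiftCfg v (pull V y) := by
  funext z κ
  rw [shiftCfg_apply, pull_apply, pull_apply, ← transl_add, add_comm v z]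

/-- **The base corners of neighbouring blocks**: the base corner `L^j·(c + e_μ)` of the block `B^j(c + e_μ)` in `T_η` is the base corner
`L^j·c` of `B^j(c)` translated by the integer vector `L^j e_μ` — wrap-around INCLUDED (`L^j·((c_μ + 1) mod N_j) ≡ L^j c_μ + L^j
(mod L^jN_j)`, `L^j·sitesPerDir j = sitesPerDir 0` in the standing range `j ≤ m + K`). (bookkeeping of the blocks (2) of [4] on the torus
of [Balaban1987RG1] (0.1), no content of the series) [cite: Balaban1985Averaging, (2) p.17; Balaban1987RG1, (0.1) p.251] -/
theorem fine_shift (hj : j ≤ P.m + P.K) (c : Site P j) (μ : Fin P.d) :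
    fine P j (c.shift μ) = transl (fine P j c) (((P.L : ℤ) ^ j) • e μ) := by
  funext κ
  rw [transl_apply]
  by_cases hκ : κ = μ
  · subst hκ
    have hs : (c.shift κ) κ = c κ + 1 := by rw [Site.shift_apply, if_pos rfl]
    have hmod : ((c.shift κ) κ).val ≡ (c κ).val + 1 [MOD P.sitesPerDir j] := by
      rw [← ZMod.natCast_eq_natCast_iff, ZMod.natCast_zmod_val, hs, Nat.cast_add, ZMod.natCast_zmod_val, Nat.cast_one]
    have hmod' : P.L ^ j * ((c.shift κ) κ).val ≡ P.L ^ j * ((c κ).val + 1) [MOD P.sitesPerDir 0] := by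
      rw [← pow_mul_sitesPerDir P hj]
      exact hmod.mul_left' _
    have h1 : ((P.L ^ j * ((c.shift κ) κ).val : ℕ) : ZMod (P.sitesPerDir 0)) =
        ((P.L ^ j * ((c κ).val + 1) : ℕ) : ZMod (P.sitesPerDir 0)) :=
      (ZMod.natCast_eq_natCast_iff _ _ _).mpr hmod'
    show ((P.L ^ j * ((c.shift κ) κ).val : ℕ) : ZMod (P.sitesPerDir 0)) =
      ((P.L ^ j * (c κ).val : ℕ) : ZMod (P.sitesPerDir 0)) + _
    rw [h1]
    simp only [Pi.smul_apply, smul_eq_mul, e_apply]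
    push_cast
    ring
  · have hs : (c.shift μ) κ = c κ := by rw [Site.shift_apply, if_neg hκ]
    show ((P.L ^ j * ((c.shift μ) κ).val : ℕ) : ZMod (P.sitesPerDir 0)) =
      ((P.L ^ j * (c κ).val : ℕ) : ZMod (P.sitesPerDir 0)) + _
    rw [hs]
    simp only [Pi.smul_apply, smul_eq_mul, e_apply, if_neg hκ, mul_zero, Int.cast_zero, add_zero]

end Dictionary

section Average

open scoped Matrix.Norms.L2Operator

variable {j : ℕ} {N : ℕ}

/-- **`Ū^j` — THE `j`-FOLD AVERAGE (42)–(43) OF [4] OF A `U(N)`-VALUED CONFIGURATION ON THE TORUS `T_η`, AS A CONFIGURATION ON `T^{(j)}`**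
(values in `M_N(ℂ)ˣ`): at the bond `c = ⟨c₋, c₋ + e_κ⟩` of `T^{(j)}`, `Ū^j_c := Ū♯^j(0, κ)` — the `j`-fold `ℤ^d` average
`B7Prop2Explicit.avgIter` of the periodic pullback `U♯_{x(c₋)}` based at the base corner `x(c₋) = L^j·c₋` of the block `B^j(c₋)`, at the
coarse bond from the origin in direction `κ` (by the locality of (43), [4] p. 24, it sees only `U_b`, `b ⊂ B^j(c₋) ∪ B^j(c₊)`; [4] p. 19
«Ω^{(j)} may be replaced by any other lattice»). [cite: Balaban1985Averaging, (42)–(43) pp.23–24; Balaban1985UV3, (67) p.273] -/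
def avgT (j : ℕ) (U : GaugeField P 0 (Matrix.unitaryGroup (Fin N) ℂ)) :
    GaugeField P j (Matrix (Fin N) (Fin N) ℂ)ˣ :=
  fun b => avgIter P.L (pull (unitsField U) (fine P j b.src)) j 0 b.dir

/-- Unfolding `avgT`. [cite: Balaban1985Averaging, (43) p.24] -/
theorem avgT_apply (U : GaugeField P 0 (Matrix.unitaryGroup (Fin N) ℂ)) (b : PBond P j) :
    avgT j U b = avgIter P.L (pull (unitsField U) (fine P j b.src)) j 0 b.dir := rfl

/-- The bond variables of `Ū^j` at the shifted sites `c + e_κ` read from the base point of `c`: `Ū^j(c + e_κ, κ′) = Ū♯^j_{x(c)}(e_κ, κ′)`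
— translation covariance of (43) (`B7TranslationCovariance.avgIter_shiftCfg`: a translation by `a` of the `j`-th lattice is the
translation by `L^ja` of the fine lattice) with `pull_transl` and `fine_shift`. [cite: Balaban1985Averaging, (43) p.24, p.19] -/
theorem avgT_shift (hj : j ≤ P.m + P.K) (U : GaugeField P 0 (Matrix.unitaryGroup (Fin N) ℂ)) (c : Site P j) (κ κ' : Fin P.d) :
    avgT j U ⟨c.shift κ, κ'⟩ = avgIter P.L (pull (unitsField U) (fine P j c)) j (0 + e κ) κ' := by
  rw [avgT_apply, avgIter_shiftCfg, ← pull_transl, ← fine_shift hj]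

/-- **`Ū^j(∂p′)` ON THE TORUS IS THE `ℤ^d` PLAQUETTE VARIABLE OF THE AVERAGE OF THE PULLBACK**: for the plaquette `p′ = ⟨c; μ, ν⟩` of
`T^{(j)}`, `Ū^j(∂p′)` (the torus transport `holT` of `avgT j U` around `p′`) `=` `hol (avgIter L U♯_{x₀} j) 0 (plaqWord μ ν)`, `x₀♭ =
L^j·c` the base corner of `B^j(x₀)`. [cite: Balaban1985UV3, (67), (69) p.273; Balaban1985Averaging, (43) p.24, (9) p.18] -/
theorem holT_avgT_plaqWord (hj : j ≤ P.m + P.K) (U : GaugeField P 0 (Matrix.unitaryGroup (Fin N) ℂ)) (c : Site P j)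
    (μ ν : Fin P.d) :
    holT (avgT j U) c (plaqWord μ ν) = hol (avgIter P.L (pull (unitsField U) (fine P j c)) j) 0 (plaqWord μ ν) := by
  rw [holT_plaqWord, B7Prop1Local.hol_plaqWord_eq, avgT_shift hj, avgT_shift hj, avgT_apply, avgT_apply]

/-- **(67) PLAQUETTE-WISE FROM (67) BOND-WISE**: «Ū_k^j = V_j on Λ_j» on the four bonds of `p′ ⊂ Λ_j` (as matrices) gives
`Ū_k^j(∂p′) = V_j(∂p′)` (the hypothesis `h67` of §4). [cite: Balaban1985UV3, (67) p.273] -/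
theorem h67_of_bonds [NeZero N] (U : GaugeField P 0 (Matrix.unitaryGroup (Fin N) ℂ)) (Vj : GaugeField P j (Matrix.unitaryGroup (Fin N) ℂ))
    (p' : Plaq P j)
    (h₁ : ((avgT j U ⟨p'.src, p'.μ⟩ : (Matrix (Fin N) (Fin N) ℂ)ˣ) : Matrix (Fin N) (Fin N) ℂ) =
      ((Vj ⟨p'.src, p'.μ⟩ : Matrix.unitaryGroup (Fin N) ℂ) : Matrix (Fin N) (Fin N) ℂ))
    (h₂ : ((avgT j U ⟨p'.src.shift p'.μ, p'.ν⟩ : (Matrix (Fin N) (Fin N) ℂ)ˣ) : Matrix (Fin N) (Fin N) ℂ) =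
      ((Vj ⟨p'.src.shift p'.μ, p'.ν⟩ : Matrix.unitaryGroup (Fin N) ℂ) : Matrix (Fin N) (Fin N) ℂ))
    (h₃ : ((avgT j U ⟨p'.src.shift p'.ν, p'.μ⟩ : (Matrix (Fin N) (Fin N) ℂ)ˣ) : Matrix (Fin N) (Fin N) ℂ) =
      ((Vj ⟨p'.src.shift p'.ν, p'.μ⟩ : Matrix.unitaryGroup (Fin N) ℂ) : Matrix (Fin N) (Fin N) ℂ))
    (h₄ : ((avgT j U ⟨p'.src, p'.ν⟩ : (Matrix (Fin N) (Fin N) ℂ)ˣ) : Matrix (Fin N) (Fin N) ℂ) =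
      ((Vj ⟨p'.src, p'.ν⟩ : Matrix.unitaryGroup (Fin N) ℂ) : Matrix (Fin N) (Fin N) ℂ)) :
    ((holT (avgT j U) p'.src (plaqWord p'.μ p'.ν) : (Matrix (Fin N) (Fin N) ℂ)ˣ) : Matrix (Fin N) (Fin N) ℂ) =
      ((GaugeField.plaqHol Vj p' : Matrix.unitaryGroup (Fin N) ℂ) : Matrix (Fin N) (Fin N) ℂ) := by
  have e₁ : avgT j U ⟨p'.src, p'.μ⟩ = unitsField Vj ⟨p'.src, p'.μ⟩ := Units.ext h₁
  have e₂ : avgT j U ⟨p'.src.shift p'.μ, p'.ν⟩ = unitsField Vj ⟨p'.src.shift p'.μ, p'.ν⟩ := Units.ext h₂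
  have e₃ : avgT j U ⟨p'.src.shift p'.ν, p'.μ⟩ = unitsField Vj ⟨p'.src.shift p'.ν, p'.μ⟩ := Units.ext h₃
  have e₄ : avgT j U ⟨p'.src, p'.ν⟩ = unitsField Vj ⟨p'.src, p'.ν⟩ := Units.ext h₄
  have key : holT (avgT j U) p'.src (plaqWord p'.μ p'.ν) = holT (unitsField Vj) p'.src (plaqWord p'.μ p'.ν) := by
    rw [holT_plaqWord, holT_plaqWord, e₁, e₂, e₃, e₄]
  rw [key, val_holT_unitsField, holT_plaqWord_eq_plaqHol]

end Average

/-! ## §2 `Δ′(p′)` with all orientations on the torus, the `ℤ^d` box, and the (69) sum of the pullback -/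

section DeltaAll

variable {j : ℕ}

/-- **THE FINE PLAQUETTES `p ⊂ Δ′ = B^j(x₀) ∪ B^j(y₀) ∪ B^j(z₀) ∪ B^j(w₀)` OF ALL ORIENTATIONS** (print's locus of (68) «on B^j(Λ_j)»
restricted to the four blocks at the corners of `p′ ⊂ Λ_j`, and of [4] p. 26 «it is enough to assume (52) for p ⊂ B^k(x) ∪ B^k(y) ∪
B^k(z) ∪ B^k(w)»): the fine plaquettes of `T_η` whose lower-left AND upper-right corners have their `j`-block among the four corners of
`p′` (hence all four corners, the union of the four blocks being a box). [cite: Balaban1985UV3, (68), (70) p.273; Balaban1985Averaging, p.26 (sentence after (54))] -/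
def deltaAllT (j : ℕ) (p : Plaq P j) : Finset (Plaq P 0) :=
  Finset.univ.filter fun q => blockIter j q.src ∈ cornersJ p ∧ blockIter j ((q.src.shift q.μ).shift q.ν) ∈ cornersJ p

/-- Membership in `deltaAllT`. [cite: Balaban1985UV3, (68) p.273] -/
theorem mem_deltaAllT_iff {p : Plaq P j} {q : Plaq P 0} :
    q ∈ deltaAllT j p ↔ blockIter j q.src ∈ cornersJ p ∧ blockIter j ((q.src.shift q.μ).shift q.ν) ∈ cornersJ p := by
  simp [deltaAllT]

/-- The box `[L^j·0, L^j·0 + (L^j − 1)𝟙 + L^j e_μ + L^j e_ν]` of `B7Prop1Local` (the union of the four `j`-blocks at the corners of the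
coarse plaquette `(0; μ, ν)`, [4] p. 26) is the box `deltaBox L^j 0 μ ν` of `B10Eq70Squaring` (PROVED there equal to «B^j(x₀) ∪ B^j(y₀)
∪ B^j(z₀) ∪ B^j(w₀)»). [cite: Balaban1985UV3, (70) p.273; Balaban1985Averaging, p.26 (sentence after (54))] -/
theorem mem_deltaBox_of_inBox (p : Plaq P j) {w : LSite P.d}
    (hw : InBox (loK P.L j 0) (plaqHiK P.L j 0 p.μ p.ν) w) : w ∈ deltaBox (P.L ^ j) (0 : LSite P.d) p.μ p.ν := by
  rw [mem_deltaBox]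
  intro κ
  have h := hw κ
  simp only [loK, plaqHiK, Pi.zero_apply, mul_zero, zero_add] at h
  simp only [sub_zero]
  unfold B10Eq70Squaring.side
  by_cases hκ : κ = p.μ ∨ κ = p.ν
  · rw [if_pos hκ] at h
    rw [if_pos hκ]
    push_cast
    constructor <;> linarith [h.1, h.2]
  · rw [if_neg hκ] at h
    rw [if_neg hκ]
    push_cast
    constructor <;> linarith [h.1, h.2]

/-- **THE BOX MAPS INTO `deltaAllT`**: a unit plaquette `(w; κ, μ′)` of the pullback lattice lying in the box (both extreme corners,
`B7Prop1Local.PlaqIn`) names the fine torus plaquette `⟨x₀♭ + w; κ < μ′⟩`, which belongs to `deltaAllT j p′` (its corners' `j`-blocks are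
corners of `p′`: `B10Eq71TorusLocal.plaqAt_mem_deltaT`, the label identity of gen 56, and `transl_add_e`). [cite: Balaban1985UV3, (68), (70) p.273] -/
theorem mem_deltaAllT_of_plaqIn (hj : j ≤ P.m + P.K) (p : Plaq P j) {w : LSite P.d} {κ μ : Fin P.d} (hκμ : κ < μ)
    (hw : PlaqIn (loK P.L j 0) (plaqHiK P.L j 0 p.μ p.ν) (w, κ, μ)) :
    (⟨transl (fine P j p.src) w, κ, μ, hκμ⟩ : Plaq P 0) ∈ deltaAllT j p := by
  rw [mem_deltaAllT_iff]
  have h1 := (mem_deltaT_iff.mp (plaqAt_mem_deltaT hj p (mem_deltaBox_of_inBox p hw.1))).2.2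
  have h2 := (mem_deltaT_iff.mp (plaqAt_mem_deltaT hj p (mem_deltaBox_of_inBox p hw.2))).2.2
  rw [plaqAt_src] at h1 h2
  rw [transl_add_e, transl_add_e] at h2
  exact ⟨h1, h2⟩

/-- The sub-plaquettes `p ⊂ (p′)_x`, `x ∈ B^j(x₀)` (index `t = (r, i, i′)` of `B10Eq70Squaring`, corner `x₀ + boxVec r + i e_μ + i′ e_ν`)
belong to `deltaAllT j p′` (they lie inside `Δ′`: `B10Eq69Local.plaqIn_translate`, p29). [cite: Balaban1985UV3, (69)–(70) p.273] -/
theorem plaqAt_corner_mem_deltaAllT (hj : j ≤ P.m + P.K) (p : Plaq P j) (t : Idx P.d (P.L ^ j)) :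
    plaqAt p (corner (P.L ^ j) (0 : LSite P.d) p.μ p.ν t) ∈ deltaAllT j p := by
  have h := B10Eq69Local.plaqIn_translate P.L j (0 : LSite P.d) (ne_of_lt p.hμν) t.1 t.2.1.isLt t.2.2.isLt
  rw [smul_zero] at h
  exact mem_deltaAllT_of_plaqIn hj p p.hμν h

end DeltaAll

section Sum69

open scoped Matrix.Norms.L2Operator

variable {j : ℕ} {N : ℕ} [NeZero N]

/-- Pointwise: the plaquette deviation `|U♯_{x₀}(∂(w; μ, ν)) − 1|` of the pullback (`B10Eq70Squaring.dev`) is `dist1` of the torus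
plaquette variable at `x₀♭ + w` (`hol_pull` + `norm_holT_unitsField_plaqWord_sub_one`, gen 54), i.e. the pulled-back plaquette function
`B10Eq71TorusLocal.pullFn p′ (dist1 ∘ plaqHol U)`. [cite: Balaban1985UV3, (69) p.273] -/
theorem dev_pull_unitsField (U : GaugeField P 0 (Matrix.unitaryGroup (Fin N) ℂ)) (p : Plaq P j) (w : LSite P.d) :
    dev (pull (unitsField U) (fine P j p.src)) p.μ p.ν w =
      pullFn p (fun q => dist1 (GaugeField.plaqHol U q)) w := by
  unfold B10Eq70Squaring.dev
  rw [pullFn_apply, hol_pull, norm_holT_unitsField_plaqWord_sub_one U _ p.hμν]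
  rfl

/-- **THE (69) SUM OF THE PULLBACK IS THE TORUS (69) SUM**: `Σ_{x∈B^j(0)} L^{−dj} Σ_{p⊂(0;μ,ν)_x} |U♯_{x₀}(∂p) − 1|`
(`B10Eq70Squaring.blockSum` at the base point `0`, the right-hand side of p29's `ℤ^d` (69) for the pullback) `=`
`B10Eq71TorusLocal.blockSumT j p′ (dist1 ∘ plaqHol U)` (the printed double sum on `T_η`, gen 56). [cite: Balaban1985UV3, (69) p.273] -/
theorem blockSum_dev_pull_eq_blockSumT (U : GaugeField P 0 (Matrix.unitaryGroup (Fin N) ℂ)) (p : Plaq P j) :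
    blockSum (P.L ^ j) (0 : LSite P.d) p.μ p.ν (dev (pull (unitsField U) (fine P j p.src)) p.μ p.ν) =
      blockSumT j p (fun q => dist1 (GaugeField.plaqHol U q)) := by
  have h : dev (pull (unitsField U) (fine P j p.src)) p.μ p.ν = pullFn p (fun q => dist1 (GaugeField.plaqHol U q)) :=
    funext (dev_pull_unitsField U p)
  rw [h]
  rfl

/-- **(68) ON `Δ′(p′)` FEEDS THE LOCAL (52)/(68) OF THE PULLBACK**: if `dist1 (plaqHol U q) ≤ θ` (`θ ≥ 0`) for every fine plaquette
`q ∈ deltaAllT j p′`, then `B7Prop1Local.pdevOn` of the pullback `U♯_{x₀}` over the box `[0, (L^j − 1)𝟙 + L^j(e_μ + e_ν)]` — the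
hypothesis `h68` of `B10Eq69Local.eq69_local` at the coarse plaquette `(0; μ, ν)` — is `≤ θ` (both orientations: `h13_unitsField`,
gen 54; degenerate words `κ = κ′` transport to `1`). [cite: Balaban1985UV3, (68) p.273; Balaban1985Averaging, (52) p.26] -/
theorem pdevOn_pull_le (hj : j ≤ P.m + P.K) (U : GaugeField P 0 (Matrix.unitaryGroup (Fin N) ℂ)) (p : Plaq P j) {θ : ℝ}
    (hθ : 0 ≤ θ) (h68 : ∀ q ∈ deltaAllT j p, dist1 (GaugeField.plaqHol U q) ≤ θ) :
    pdevOn (loK P.L j 0) (plaqHiK P.L j 0 p.μ p.ν) (pull (unitsField U) (fine P j p.src)) ≤ θ := by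
  have h13 := h13_unitsField (lo := loK P.L j 0) (hi := plaqHiK P.L j 0 p.μ p.ν) U (fine P j p.src) (α := θ)
    (fun z κ μ hκμ hp => h68 _ (mem_deltaAllT_of_plaqIn hj p hκμ hp))
  unfold B7Prop1Local.pdevOn
  refine Real.iSup_le (fun q => ?_) hθ
  obtain ⟨⟨z, κ, μ⟩, hq⟩ := q
  dsimp only
  rcases eq_or_ne κ μ with rfl | hne
  · rw [hol_plaqWord_self]
    simp [hθ]
  · rw [hol_pull]
    exact h13 z κ μ hne hq

/-! ## §3 (69) ON THE TORUS -/

/-- **[Balaban1985UV3] (69) ON THE TORUS CARRIER OF RECORD FOR PRINT'S OWN AVERAGING** («Applying the inequalities (50), (53) [4], we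
have |Ū_k^j(∂p′) − 1| < Σ_{x∈B^j(x₀)} L^{−3j} Σ_{p⊂(p′)_x} |U_k(∂p) − 1| + O(1)(g_jp(g_j))²», general `d`, the `O(1)` explicit): let `U`
be a `U(N)`-valued configuration on `T_η` (`U_k`), `p′` a plaquette of `T^{(j)}` (`j ≤ m + K`), `Ū^j = avgT j U` the `j`-fold average
(43) of [4]; assume (68) in the form `dist1 (plaqHol U q) ≤ θ` for every fine plaquette `q ⊂ Δ′(p′)` (all orientations, `deltaAllT`) with
`θ < α₀L^{−2j}`, where `α₀` obeys the Prop.-2 smallness of [4] (`0 < α₀`, `C₀α₀ ≤ ⅓`, `2α₀ ≤ c₂′(d, L)`; print: `α₀ = O(1)g_jp(g_j)`).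
THEN  **`‖Ū^j(∂p′) − 1‖ ≤ Σ_{x∈B^j(x₀)} L^{−dj} Σ_{p⊂(p′)_x} |U(∂p) − 1| + (16/3)C₀α₀²`**  (`blockSumT` the printed double sum on the
torus).  Proof = p29's `B10Eq69Local.eq69_local` ((50), (53) of [4] with the printed locality, on `ℤ^d`) for the periodic pullback
`U♯_{x₀}` at the coarse plaquette `(0; μ, ν)`, whose left side is `Ū^j(∂p′)` (`holT_avgT_plaqWord`) and whose right side is the torus sum
(`blockSum_dev_pull_eq_blockSumT`), its hypothesis supplied by `pdevOn_pull_le`. [cite: Balaban1985UV3, (68)–(69) p.273; Balaban1985Averaging, Prop. 1 (50)–(51) pp.25–26, (53)–(54) p.26] -/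
theorem eq69_torus (hj : j ≤ P.m + P.K) (U : GaugeField P 0 (Matrix.unitaryGroup (Fin N) ℂ)) (p : Plaq P j)
    {α₀ θ : ℝ} (hα : 0 < α₀) (hα3 : C0 P.d * α₀ ≤ 1 / 3) (hα2 : 2 * α₀ ≤ c2' P.d P.L)
    (h68 : ∀ q ∈ deltaAllT j p, dist1 (GaugeField.plaqHol U q) ≤ θ)
    (hθ : θ < α₀ * (((P.L : ℝ) ^ j)⁻¹) ^ 2) :
    ‖((holT (avgT j U) p.src (plaqWord p.μ p.ν) : (Matrix (Fin N) (Fin N) ℂ)ˣ) : Matrix (Fin N) (Fin N) ℂ) - 1‖ ≤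
      blockSumT j p (fun q => dist1 (GaugeField.plaqHol U q)) + 16 / 3 * C0 P.d * α₀ ^ 2 := by
  letI : CStarAlgebra (Matrix (Fin N) (Fin N) ℂ) := B10Eq29TubeLine.cstarAlgebraMatrix N
  have hL : 2 ≤ P.L := P.hL.2
  have hLj : (0 : ℝ) < ((P.L : ℝ) ^ j)⁻¹ := by
    have : (0 : ℝ) < (P.L : ℝ) ^ j := by
      have hL0 : (0 : ℝ) < P.L := by exact_mod_cast P.L_pos
      positivity
    positivity
  -- (68) on `Δ′` ⇒ the local (52) of the pullback, strictly below `α₀L^{−2j}`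
  have hθ' : max θ 0 < α₀ * (((P.L : ℝ) ^ j)⁻¹) ^ 2 := max_lt hθ (by positivity)
  have hU : ∀ x κ, pull (unitsField U) (fine P j p.src) x κ ∈ unitaryUnits (Matrix (Fin N) (Fin N) ℂ) :=
    fun x κ => unitsField_mem_unitaryUnits U _
  have h68' : pdevOn (loK P.L j 0) (plaqHiK P.L j 0 p.μ p.ν) (pull (unitsField U) (fine P j p.src)) <
      α₀ * (((P.L : ℝ) ^ j)⁻¹) ^ 2 :=
    (pdevOn_pull_le hj U p (le_max_right θ 0) (fun q hq => (h68 q hq).trans (le_max_left _ _))).trans_lt hθ'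
  -- p29's (69) on `ℤ^d` with the printed locality, for the pullback at the coarse plaquette `(0; μ, ν)`
  have h := B10Eq69Local.eq69_local P.L hL (avgClosed_unitaryUnits P.d P.L) j (pull (unitsField U) (fine P j p.src))
    hU hα hα3 hα2 (0 : LSite P.d) (ne_of_lt p.hμν) h68'
  rw [B10Eq69Local.transSum_eq_blockSum, smul_zero, blockSum_dev_pull_eq_blockSumT, ← holT_avgT_plaqWord hj U p.src p.μ p.ν]
    at h
  exact h

/-- (69) with the remainder in print's shape `O(1)·α₀²` packaged: `∃ b, 0 ≤ b ≤ (16/3)C₀α₀²` and `‖Ū^j(∂p′) − 1‖ ≤ S + b` — the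
hypothesis `h69` of `B10Eq71TorusLocal.sq_le_of_le69_torus` / `smallFactor_of_largeField_torus` for `v = ‖Ū^j(∂p′) − 1‖`.
[cite: Balaban1985UV3, (69) p.273] -/
theorem eq69_torus_shape (hj : j ≤ P.m + P.K) (U : GaugeField P 0 (Matrix.unitaryGroup (Fin N) ℂ)) (p : Plaq P j)
    {α₀ θ : ℝ} (hα : 0 < α₀) (hα3 : C0 P.d * α₀ ≤ 1 / 3) (hα2 : 2 * α₀ ≤ c2' P.d P.L)
    (h68 : ∀ q ∈ deltaAllT j p, dist1 (GaugeField.plaqHol U q) ≤ θ)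
    (hθ : θ < α₀ * (((P.L : ℝ) ^ j)⁻¹) ^ 2) :
    ∃ b : ℝ, 0 ≤ b ∧ b ≤ 16 / 3 * C0 P.d * α₀ ^ 2 ∧
      ‖((holT (avgT j U) p.src (plaqWord p.μ p.ν) : (Matrix (Fin N) (Fin N) ℂ)ˣ) : Matrix (Fin N) (Fin N) ℂ) - 1‖ ≤
        blockSumT j p (fun q => dist1 (GaugeField.plaqHol U q)) + b :=
  ⟨16 / 3 * C0 P.d * α₀ ^ 2, by have := (C0_pos P.d).le; positivity, le_rfl, eq69_torus hj U p hα hα3 hα2 h68 hθ⟩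

end Sum69

/-! ## §4 Sect. D's small factor for ONE large-field plaquette on the torus, `d = 3`, with (69) DISCHARGED for print's averaging -/

section SmallFactor

open scoped Matrix.Norms.L2Operator

variable {j : ℕ} {N : ℕ} [NeZero N]

/-- **[Balaban1985UV3] (67)–(71) p. 273 FOR ONE LARGE-FIELD PLAQUETTE ON THE TORUS CARRIER OF RECORD, `G = U(N)`, `d = 3`, WITH (69)
PROVED FOR PRINT'S AVERAGING** (the `h69` of `B10Eq71TorusLocal.smallFactor_of_largeField_torus` discharged by `eq69_torus`).  Data: the
fine configuration `U = U_k` on `T_η` (`U(N)`-valued, `|·|` the operator norm), a level-`j` plaquette `p′` (`j ≤ m + K`, `j ≤ k`) and the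
field `V_j` on `T^{(j)}`.  Hypotheses AS PRINTED: **(67)** `Ū_k^j(∂p′) = V_j(∂p′)` (`Ū_k^j = avgT j U`, equality in `M_N(ℂ)`); the large-field
condition «|V_j(∂p′) − 1| ≥ g_jp(g_j)»; **(68)** `|U_k(∂q) − 1| ≤ C₁g_jp(g_j)L^{−2j}` for the fine plaquettes `q ⊂ Δ′(p′)` (all
orientations, `deltaAllT`); `g_k² = g_j²L^{k−j}` (p. 256 `g_k = g(L^kε)^{1/2}`); «for g_j sufficiently small» = `0 < g_jp(g_j) ≤ 1`, the
Prop.-2 smallness of [4] for `α₀ = 2C₁g_jp(g_j)` (`C₀α₀ ≤ ⅓`, `2α₀ ≤ c₂′(3, L)`), and `½(2C₁C₂ + C₂²)g_jp(g_j) ≤ ¼` with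
`C₂ = (64/3)C₀C₁²` (the `O(1)` of (69)).  THEN **`¼p²(g_j) ≤ (1/g_k²)·η⁻¹·Σ_{q∈Δ′(p′)} N[1 − Re tr U_k(∂q)]`** (`η⁻¹ = L^k`; `Δ′(p′)` =
`B10Eq71TorusOverlap.deltaT j p′`, the parallel plaquettes summed in (70); `act(q) = N(1 − Re tr U(∂q))`, the operator-norm reading of
(11), cell DIVERGENCE D-b10.1): «the part of the action 1/g_k²A^η(U_k) localized to the sum of four j-blocks Δ′ connected with the
plaquette p′ can be bounded from below by 1/4p²(g_j)».  (69) = `eq69_torus`; (70) = `B10Eq71TorusLocal.sq_le_of_le69_torus_d3`; (71) =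
`B10Eq70Squaring.ineq71`; (11) = `B10Eq71TorusLocal.dist1_sq_le_unitaryGroup` — all BY NAME. [cite: Balaban1985UV3, (67)–(71) p.273, (11) p.258] -/
theorem smallFactor_of_largeField_torus_concrete (hd : P.d = 3) (hj : j ≤ P.m + P.K) {k : ℕ} (hjk : j ≤ k)
    (U : GaugeField P 0 (Matrix.unitaryGroup (Fin N) ℂ)) (Vj : GaugeField P j (Matrix.unitaryGroup (Fin N) ℂ))
    (p' : Plaq P j) {gj gk p C₁ : ℝ} (hgj : 0 < gj) (hgk : gk ^ 2 = gj ^ 2 * (P.L : ℝ) ^ (k - j)) (hp : 0 < p)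
    (hC₁ : 0 < C₁) (hgp : gj * p ≤ 1)
    (h67 : ((holT (avgT j U) p'.src (plaqWord p'.μ p'.ν) : (Matrix (Fin N) (Fin N) ℂ)ˣ) : Matrix (Fin N) (Fin N) ℂ) =
      ((GaugeField.plaqHol Vj p' : Matrix.unitaryGroup (Fin N) ℂ) : Matrix (Fin N) (Fin N) ℂ))
    (hLF : gj * p ≤ dist1 (GaugeField.plaqHol Vj p'))
    (h68 : ∀ q ∈ deltaAllT j p', dist1 (GaugeField.plaqHol U q) ≤ C₁ * (gj * p) / ((P.L : ℝ) ^ j) ^ 2)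
    (hα3 : C0 3 * (2 * C₁ * (gj * p)) ≤ 1 / 3) (hα2 : 2 * (2 * C₁ * (gj * p)) ≤ c2' 3 P.L)
    (hsmall : (2 * C₁ * (64 / 3 * C0 3 * C₁ ^ 2) + (64 / 3 * C0 3 * C₁ ^ 2) ^ 2) / 2 * gj * p ≤ 1 / 4) :
    p ^ 2 / 4 ≤ (gk ^ 2)⁻¹ * ((P.L : ℝ) ^ k *
      ∑ q ∈ deltaT j p', (N : ℝ) * (1 - reTr (GaugeField.plaqHol U q))) := by
  set α₀ : ℝ := 2 * C₁ * (gj * p) with hα₀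
  have hα : 0 < α₀ := by positivity
  have hα3' : C0 P.d * α₀ ≤ 1 / 3 := by rw [hd]; exact hα3
  have hα2' : 2 * α₀ ≤ c2' P.d P.L := by rw [hd]; exact hα2
  have hL0 : (0 : ℝ) < P.L := by exact_mod_cast P.L_pos
  have hLj : (0 : ℝ) < (P.L : ℝ) ^ j := by positivity
  -- (68) with `O(1) = C₁` is strictly below `α₀L^{−2j}`, `α₀ = 2C₁g_jp`
  have hθ : C₁ * (gj * p) / ((P.L : ℝ) ^ j) ^ 2 < α₀ * (((P.L : ℝ) ^ j)⁻¹) ^ 2 := by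
    rw [inv_pow, ← div_eq_mul_inv]
    apply div_lt_div_of_pos_right _ (by positivity)
    have : 0 < C₁ * (gj * p) := by positivity
    rw [hα₀]
    linarith
  -- (69) on the torus for print's averaging, then (67)
  have h69 := eq69_torus hj U p' hα hα3' hα2' h68 hθ
  rw [h67] at h69
  have hC0 : C0 P.d = C0 3 := by rw [hd]
  rw [hC0] at h69
  have hv0 : 0 ≤ dist1 (GaugeField.plaqHol Vj p') := GaugeGroup.dist1_nonneg _
  have h69' : dist1 (GaugeField.plaqHol Vj p') ≤
      blockSumT j p' (fun q => dist1 (GaugeField.plaqHol U q)) + 16 / 3 * C0 3 * α₀ ^ 2 := h69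
  have hb : 0 ≤ 16 / 3 * C0 3 * α₀ ^ 2 := by have := (C0_pos 3).le; positivity
  have hbB : 16 / 3 * C0 3 * α₀ ^ 2 ≤ (64 / 3 * C0 3 * C₁ ^ 2) * (gj * p) ^ 2 := le_of_eq (by rw [hα₀]; ring)
  -- (68) on the sub-plaquettes of the translates (they lie in `Δ′`)
  have h68' : ∀ t : Idx P.d (P.L ^ j),
      dist1 (GaugeField.plaqHol U (plaqAt p' (corner (P.L ^ j) (0 : LSite P.d) p'.μ p'.ν t))) ≤
        C₁ * (gj * p) / ((P.L : ℝ) ^ j) ^ 2 :=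
    fun t => h68 _ (plaqAt_corner_mem_deltaAllT hj p' t)
  -- (11) for `U(N)` on `Δ′(p′)`
  have hact : ∀ q ∈ deltaT j p', dist1 (GaugeField.plaqHol U q) ^ 2 ≤ 2 * ((N : ℝ) * (1 - reTr (GaugeField.plaqHol U q))) :=
    fun q _ => dist1_sq_le_unitaryGroup _
  -- (70)
  have h70 := sq_le_of_le69_torus_d3 hd hj p' (F := fun q => dist1 (GaugeField.plaqHol U q))
    (act := fun q => (N : ℝ) * (1 - reTr (GaugeField.plaqHol U q)))
    (fun q => GaugeGroup.dist1_nonneg _) hact hv0 h69' hb hbB (A := C₁ * (gj * p)) h68'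
  -- the cross terms: 2AB + B² ≤ (2C₁C₂ + C₂²)(g_j p)³ for g_j p ≤ 1
  set C₂ : ℝ := 64 / 3 * C0 3 * C₁ ^ 2 with hC₂
  have hε0 : 0 ≤ gj * p := by positivity
  have hC2 : 0 ≤ C₂ := by have := (C0_pos 3).le; positivity
  have hcross : 2 * (C₁ * (gj * p)) * (C₂ * (gj * p) ^ 2) + (C₂ * (gj * p) ^ 2) ^ 2 ≤
      (2 * C₁ * C₂ + C₂ ^ 2) * (gj * p) ^ 3 := by
    have h4 : (gj * p) ^ 4 ≤ (gj * p) ^ 3 := by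
      calc (gj * p) ^ 4 = (gj * p) ^ 3 * (gj * p) := by ring
        _ ≤ (gj * p) ^ 3 * 1 := mul_le_mul_of_nonneg_left hgp (by positivity)
        _ = (gj * p) ^ 3 := by ring
    have hC22 : 0 ≤ C₂ ^ 2 := sq_nonneg _
    nlinarith [mul_le_mul_of_nonneg_left h4 hC22]
  have hsum0 : 0 ≤ ∑ q ∈ deltaT j p', (N : ℝ) * (1 - reTr (GaugeField.plaqHol U q)) :=
    Finset.sum_nonneg fun q _ => mul_nonneg (Nat.cast_nonneg _) (sub_nonneg.mpr (GaugeGroup.reTr_le_one _))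
  have h70' : dist1 (GaugeField.plaqHol Vj p') ^ 2 ≤
      2 * (P.L : ℝ) ^ j * (∑ q ∈ deltaT j p', (N : ℝ) * (1 - reTr (GaugeField.plaqHol U q))) +
        (2 * C₁ * C₂ + C₂ ^ 2) * (gj * p) ^ 3 := by
    nlinarith
  exact ineq71 hL0 hjk hgj hgk hp.le hLF h70' hsmall

/-- **The small factor** («the corresponding part of the exponential gives the small factor exp(−1/4p²(g_j))»): under the hypotheses
of `smallFactor_of_largeField_torus_concrete`, `exp[−(1/g_k²)·η⁻¹·Σ_{q∈Δ′(p′)} N(1 − Re tr U(∂q))] ≤ exp(−¼p²(g_j))`. [cite: Balaban1985UV3, (71) p.273] -/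
theorem exp_localized_le_torus_concrete (hd : P.d = 3) (hj : j ≤ P.m + P.K) {k : ℕ} (hjk : j ≤ k)
    (U : GaugeField P 0 (Matrix.unitaryGroup (Fin N) ℂ)) (Vj : GaugeField P j (Matrix.unitaryGroup (Fin N) ℂ))
    (p' : Plaq P j) {gj gk p C₁ : ℝ} (hgj : 0 < gj) (hgk : gk ^ 2 = gj ^ 2 * (P.L : ℝ) ^ (k - j)) (hp : 0 < p)
    (hC₁ : 0 < C₁) (hgp : gj * p ≤ 1)
    (h67 : ((holT (avgT j U) p'.src (plaqWord p'.μ p'.ν) : (Matrix (Fin N) (Fin N) ℂ)ˣ) : Matrix (Fin N) (Fin N) ℂ) =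
      ((GaugeField.plaqHol Vj p' : Matrix.unitaryGroup (Fin N) ℂ) : Matrix (Fin N) (Fin N) ℂ))
    (hLF : gj * p ≤ dist1 (GaugeField.plaqHol Vj p'))
    (h68 : ∀ q ∈ deltaAllT j p', dist1 (GaugeField.plaqHol U q) ≤ C₁ * (gj * p) / ((P.L : ℝ) ^ j) ^ 2)
    (hα3 : C0 3 * (2 * C₁ * (gj * p)) ≤ 1 / 3) (hα2 : 2 * (2 * C₁ * (gj * p)) ≤ c2' 3 P.L)
    (hsmall : (2 * C₁ * (64 / 3 * C0 3 * C₁ ^ 2) + (64 / 3 * C0 3 * C₁ ^ 2) ^ 2) / 2 * gj * p ≤ 1 / 4) :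
    Real.exp (-((gk ^ 2)⁻¹ * ((P.L : ℝ) ^ k *
      ∑ q ∈ deltaT j p', (N : ℝ) * (1 - reTr (GaugeField.plaqHol U q))))) ≤ Real.exp (-(p ^ 2 / 4)) := by
  have h := smallFactor_of_largeField_torus_concrete hd hj hjk U Vj p' hgj hgk hp hC₁ hgp h67 hLF h68 hα3 hα2 hsmall
  exact Real.exp_le_exp.mpr (by linarith)

/-- `Re tr` reads the same in `SU(N)` and in `U(N)` (both cell instances are `Re Tr / N` of the same matrix). (bookkeeping of the U(N) model
of [Balaban1985Averaging] (19), no content of the series) [cite: Balaban1985Averaging, (19) p.21] -/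
theorem reTr_suIncl (g : Matrix.specialUnitaryGroup (Fin N) ℂ) : reTr (suIncl g) = reTr g := rfl

/-- **The same for the semi-simple model `G = SU(N)` of Theorem 1** (p. 257 «with a semi-simple compact group Lie G»): `SU(N)`-valued `U`,
`V_j` read in `U(N)` through `B10Eq27TorusAxialLog.toUField` (`Ū^j = avgT j (toUField U)`); hypotheses and conclusion in the cell's
`SU(N)` letters (`dist1`, `reTr` of `UnitaryModel.instGaugeGroupSpecialUnitaryGroup`). [cite: Balaban1985UV3, (67)–(71) p.273, Thm 1 p.257] -/
theorem smallFactor_of_largeField_torus_concrete_specialUnitaryGroup (hd : P.d = 3) (hj : j ≤ P.m + P.K) {k : ℕ}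
    (hjk : j ≤ k) (U : GaugeField P 0 (Matrix.specialUnitaryGroup (Fin N) ℂ))
    (Vj : GaugeField P j (Matrix.specialUnitaryGroup (Fin N) ℂ))
    (p' : Plaq P j) {gj gk p C₁ : ℝ} (hgj : 0 < gj) (hgk : gk ^ 2 = gj ^ 2 * (P.L : ℝ) ^ (k - j)) (hp : 0 < p)
    (hC₁ : 0 < C₁) (hgp : gj * p ≤ 1)
    (h67 : ((holT (avgT j (toUField U)) p'.src (plaqWord p'.μ p'.ν) : (Matrix (Fin N) (Fin N) ℂ)ˣ) : Matrix (Fin N) (Fin N) ℂ) =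
      ((GaugeField.plaqHol Vj p' : Matrix.specialUnitaryGroup (Fin N) ℂ) : Matrix (Fin N) (Fin N) ℂ))
    (hLF : gj * p ≤ dist1 (GaugeField.plaqHol Vj p'))
    (h68 : ∀ q ∈ deltaAllT j p', dist1 (GaugeField.plaqHol U q) ≤ C₁ * (gj * p) / ((P.L : ℝ) ^ j) ^ 2)
    (hα3 : C0 3 * (2 * C₁ * (gj * p)) ≤ 1 / 3) (hα2 : 2 * (2 * C₁ * (gj * p)) ≤ c2' 3 P.L)
    (hsmall : (2 * C₁ * (64 / 3 * C0 3 * C₁ ^ 2) + (64 / 3 * C0 3 * C₁ ^ 2) ^ 2) / 2 * gj * p ≤ 1 / 4) :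
    p ^ 2 / 4 ≤ (gk ^ 2)⁻¹ * ((P.L : ℝ) ^ k *
      ∑ q ∈ deltaT j p', (N : ℝ) * (1 - reTr (GaugeField.plaqHol U q))) := by
  have h67' : ((holT (avgT j (toUField U)) p'.src (plaqWord p'.μ p'.ν) : (Matrix (Fin N) (Fin N) ℂ)ˣ) :
      Matrix (Fin N) (Fin N) ℂ) =
      ((GaugeField.plaqHol (toUField Vj) p' : Matrix.unitaryGroup (Fin N) ℂ) : Matrix (Fin N) (Fin N) ℂ) := by
    rw [h67, plaqHol_toUField, val_suIncl]
  have hLF' : gj * p ≤ dist1 (GaugeField.plaqHol (toUField Vj) p') := by rwa [dist1_plaqHol_toUField]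
  have h68' : ∀ q ∈ deltaAllT j p', dist1 (GaugeField.plaqHol (toUField U) q) ≤ C₁ * (gj * p) / ((P.L : ℝ) ^ j) ^ 2 :=
    fun q hq => by rw [dist1_plaqHol_toUField]; exact h68 q hq
  have h := smallFactor_of_largeField_torus_concrete hd hj hjk (toUField U) (toUField Vj) p' hgj hgk hp hC₁ hgp h67' hLF'
    h68' hα3 hα2 hsmall
  have e : ∑ q ∈ deltaT j p', (N : ℝ) * (1 - reTr (GaugeField.plaqHol (toUField U) q)) =
      ∑ q ∈ deltaT j p', (N : ℝ) * (1 - reTr (GaugeField.plaqHol U q)) :=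
    Finset.sum_congr rfl fun q _ => by rw [plaqHol_toUField, reTr_suIncl]
  rw [e] at h
  exact h

end SmallFactor

/-! ## §5 «We get these small factors for all plaquettes in all large fields set P» against the full action, with `h69` gone -/

section AllPlaquettes

open scoped Matrix.Norms.L2Operator

variable (M₁ : ℕ) (R : ℕ → ℝ) (Ω₀ : Set (Site P 0)) (S : (j : ℕ) → Finset (Plaq P j))
variable {N : ℕ} [NeZero N]

/-- **THE SMALL FACTORS OF ALL LARGE-FIELD PLAQUETTES OF ALL SCALES AGAINST THE FULL ACTION, `G = U(N)`, `d = 3`, FOR PRINT'S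
AVERAGING — `h71` (gen 55) AND `h69` (gen 56) BOTH DISCHARGED**: in the setting of `B10Eq71TorusOverlap.quarter_sum_le_of_local71_torus`
(the domains `Ω_j` generated by the p. 268 rule from the large-field plaquette sets `P_j = S j ⊆ plaqsIn j Ω_j`, `R(g_i)M₁ ≥ 0`, `L ∣ M₁`,
levels `j ∈ J` with `j ≤ m + K`, `j ≤ k`, the history's plaquettes `S′ j ⊆ S j`), suppose FOR EVERY `j ∈ J` AND `p′ ∈ S′ j` the printed
data of Sect. D: (67) `Ū_k^j(∂p′) = V_j(∂p′)` with `Ū_k^j = avgT j U` THE AVERAGE (43) OF [4], the large-field condition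
`g_jp_j ≤ |V_j(∂p′) − 1|`, (68) on `Δ′_j(p′)` (all orientations) with `O(1) = C₁`, the progression `g_k² = g_j²L^{k−j}`, `0 < g_jp_j ≤ 1`
and «g_j sufficiently small» (as in §4).  THEN **`¼·Σ_{j∈J} Σ_{p′∈S′ j} ¼p_j² ≤ (N/g_k²)·A^η(U_k)`** with `A^η(U_k) =
Setup.wilsonAction (L^k) U` (p. 256: «A^η(U_k(U)) = Σ_{p⊂T_η} η^{−1}[1 − Re tr U_k(U, ∂p)], η = L^{−k}») — `B10LargeFieldSum.SmallFactorsAll`'s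
inequality with `c₁ = ¼`, END TO END on the torus modulo the printed per-plaquette inputs (67), large field, (68).
[cite: Balaban1985UV3, (67)–(71) p.273, (41) p.266, (5) p.256, p.268] -/
theorem quarter_sum_le_wilsonAction_concrete (hd : P.d = 3) (hR : ∀ i, 0 ≤ R i * M₁) (hdiv : P.L ∣ M₁) (J : Finset ℕ)
    (hJ : ∀ j ∈ J, j ≤ P.m + P.K) {k : ℕ} (hJk : ∀ j ∈ J, j ≤ k) (S' : (j : ℕ) → Finset (Plaq P j))
    (hS' : ∀ j ∈ J, S' j ⊆ S j)
    (hS : ∀ j ∈ J, S j ⊆ plaqsIn j (B10Eq71TorusOverlap.Ω M₁ R Ω₀ S j))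
    (U : GaugeField P 0 (Matrix.unitaryGroup (Fin N) ℂ)) (V : (j : ℕ) → GaugeField P j (Matrix.unitaryGroup (Fin N) ℂ))
    (g : ℕ → ℝ) (pj : ℕ → ℝ) {gk C₁ : ℝ} (hC₁ : 0 < C₁)
    (hgj : ∀ j ∈ J, 0 < g j) (hgk : ∀ j ∈ J, gk ^ 2 = g j ^ 2 * (P.L : ℝ) ^ (k - j)) (hp : ∀ j ∈ J, 0 < pj j)
    (hgp : ∀ j ∈ J, g j * pj j ≤ 1)
    (h67 : ∀ j ∈ J, ∀ p' ∈ S' j,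
      ((holT (avgT j U) p'.src (plaqWord p'.μ p'.ν) : (Matrix (Fin N) (Fin N) ℂ)ˣ) : Matrix (Fin N) (Fin N) ℂ) =
        ((GaugeField.plaqHol (V j) p' : Matrix.unitaryGroup (Fin N) ℂ) : Matrix (Fin N) (Fin N) ℂ))
    (hLF : ∀ j ∈ J, ∀ p' ∈ S' j, g j * pj j ≤ dist1 (GaugeField.plaqHol (V j) p'))
    (h68 : ∀ j ∈ J, ∀ p' ∈ S' j, ∀ q ∈ deltaAllT j p',
      dist1 (GaugeField.plaqHol U q) ≤ C₁ * (g j * pj j) / ((P.L : ℝ) ^ j) ^ 2)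
    (hα3 : ∀ j ∈ J, C0 3 * (2 * C₁ * (g j * pj j)) ≤ 1 / 3) (hα2 : ∀ j ∈ J, 2 * (2 * C₁ * (g j * pj j)) ≤ c2' 3 P.L)
    (hsmall : ∀ j ∈ J, (2 * C₁ * (64 / 3 * C0 3 * C₁ ^ 2) + (64 / 3 * C0 3 * C₁ ^ 2) ^ 2) / 2 * g j * pj j ≤ 1 / 4) :
    (1 / 4 : ℝ) * ∑ j ∈ J, ∑ _p' ∈ S' j, pj j ^ 2 / 4 ≤
      ((gk ^ 2)⁻¹ * (N : ℝ)) * wilsonAction ((P.L : ℝ) ^ k) U := by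
  have hact0 : ∀ q ∈ (Finset.univ : Finset (Plaq P 0)), 0 ≤ (N : ℝ) * (1 - reTr (GaugeField.plaqHol U q)) :=
    fun q _ => mul_nonneg (Nat.cast_nonneg _) (sub_nonneg.mpr (GaugeGroup.reTr_le_one _))
  have hc : 0 ≤ (gk ^ 2)⁻¹ * (P.L : ℝ) ^ k := by positivity
  have h := B10Eq71TorusOverlap.quarter_sum_le_of_local71_torus M₁ R Ω₀ S hR hdiv J hJ S' hS' hS Finset.univ
    (fun _ _ _ _ => Finset.subset_univ _) (fun q => (N : ℝ) * (1 - reTr (GaugeField.plaqHol U q))) hact0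
    (fun j _ => pj j ^ 2 / 4) hc (fun j hj p' hp' => by
      have h1 := smallFactor_of_largeField_torus_concrete hd (hJ j hj) (hJk j hj) U (V j) p' (hgj j hj) (hgk j hj)
        (hp j hj) hC₁ (hgp j hj) (h67 j hj p' hp') (hLF j hj p' hp') (h68 j hj p' hp') (hα3 j hj) (hα2 j hj) (hsmall j hj)
      rw [mul_assoc]
      exact h1)
  have e : ((gk ^ 2)⁻¹ * (P.L : ℝ) ^ k) * ∑ q : Plaq P 0, (N : ℝ) * (1 - reTr (GaugeField.plaqHol U q)) =
      ((gk ^ 2)⁻¹ * (N : ℝ)) * wilsonAction ((P.L : ℝ) ^ k) U := by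
    unfold wilsonAction
    rw [Finset.mul_sum, Finset.mul_sum]
    refine Finset.sum_congr rfl fun q _ => ?_
    ring
  rw [← e]
  exact h

/-- The same for the semi-simple group `G = SU(N)` of Theorem 1 (`Ū_k^j = avgT j (toUField U)`). [cite: Balaban1985UV3, (71) p.273, (41) p.266, (5) p.256, Thm 1 p.257] -/
theorem quarter_sum_le_wilsonAction_concrete_specialUnitaryGroup (hd : P.d = 3) (hR : ∀ i, 0 ≤ R i * M₁) (hdiv : P.L ∣ M₁)
    (J : Finset ℕ) (hJ : ∀ j ∈ J, j ≤ P.m + P.K) {k : ℕ} (hJk : ∀ j ∈ J, j ≤ k) (S' : (j : ℕ) → Finset (Plaq P j))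
    (hS' : ∀ j ∈ J, S' j ⊆ S j)
    (hS : ∀ j ∈ J, S j ⊆ plaqsIn j (B10Eq71TorusOverlap.Ω M₁ R Ω₀ S j))
    (U : GaugeField P 0 (Matrix.specialUnitaryGroup (Fin N) ℂ))
    (V : (j : ℕ) → GaugeField P j (Matrix.specialUnitaryGroup (Fin N) ℂ))
    (g : ℕ → ℝ) (pj : ℕ → ℝ) {gk C₁ : ℝ} (hC₁ : 0 < C₁)
    (hgj : ∀ j ∈ J, 0 < g j) (hgk : ∀ j ∈ J, gk ^ 2 = g j ^ 2 * (P.L : ℝ) ^ (k - j)) (hp : ∀ j ∈ J, 0 < pj j)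
    (hgp : ∀ j ∈ J, g j * pj j ≤ 1)
    (h67 : ∀ j ∈ J, ∀ p' ∈ S' j,
      ((holT (avgT j (toUField U)) p'.src (plaqWord p'.μ p'.ν) : (Matrix (Fin N) (Fin N) ℂ)ˣ) : Matrix (Fin N) (Fin N) ℂ) =
        ((GaugeField.plaqHol (V j) p' : Matrix.specialUnitaryGroup (Fin N) ℂ) : Matrix (Fin N) (Fin N) ℂ))
    (hLF : ∀ j ∈ J, ∀ p' ∈ S' j, g j * pj j ≤ dist1 (GaugeField.plaqHol (V j) p'))
    (h68 : ∀ j ∈ J, ∀ p' ∈ S' j, ∀ q ∈ deltaAllT j p',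
      dist1 (GaugeField.plaqHol U q) ≤ C₁ * (g j * pj j) / ((P.L : ℝ) ^ j) ^ 2)
    (hα3 : ∀ j ∈ J, C0 3 * (2 * C₁ * (g j * pj j)) ≤ 1 / 3) (hα2 : ∀ j ∈ J, 2 * (2 * C₁ * (g j * pj j)) ≤ c2' 3 P.L)
    (hsmall : ∀ j ∈ J, (2 * C₁ * (64 / 3 * C0 3 * C₁ ^ 2) + (64 / 3 * C0 3 * C₁ ^ 2) ^ 2) / 2 * g j * pj j ≤ 1 / 4) :
    (1 / 4 : ℝ) * ∑ j ∈ J, ∑ _p' ∈ S' j, pj j ^ 2 / 4 ≤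
      ((gk ^ 2)⁻¹ * (N : ℝ)) * wilsonAction ((P.L : ℝ) ^ k) U := by
  have hact0 : ∀ q ∈ (Finset.univ : Finset (Plaq P 0)), 0 ≤ (N : ℝ) * (1 - reTr (GaugeField.plaqHol U q)) :=
    fun q _ => mul_nonneg (Nat.cast_nonneg _) (sub_nonneg.mpr (GaugeGroup.reTr_le_one _))
  have hc : 0 ≤ (gk ^ 2)⁻¹ * (P.L : ℝ) ^ k := by positivity
  have h := B10Eq71TorusOverlap.quarter_sum_le_of_local71_torus M₁ R Ω₀ S hR hdiv J hJ S' hS' hS Finset.univ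
    (fun _ _ _ _ => Finset.subset_univ _) (fun q => (N : ℝ) * (1 - reTr (GaugeField.plaqHol U q))) hact0
    (fun j _ => pj j ^ 2 / 4) hc (fun j hj p' hp' => by
      have h1 := smallFactor_of_largeField_torus_concrete_specialUnitaryGroup hd (hJ j hj) (hJk j hj) U (V j) p'
        (hgj j hj) (hgk j hj) (hp j hj) hC₁ (hgp j hj) (h67 j hj p' hp') (hLF j hj p' hp') (h68 j hj p' hp') (hα3 j hj)
        (hα2 j hj) (hsmall j hj)
      rw [mul_assoc]
      exact h1)
  have e : ((gk ^ 2)⁻¹ * (P.L : ℝ) ^ k) * ∑ q : Plaq P 0, (N : ℝ) * (1 - reTr (GaugeField.plaqHol U q)) =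
      ((gk ^ 2)⁻¹ * (N : ℝ)) * wilsonAction ((P.L : ℝ) ^ k) U := by
    unfold wilsonAction
    rw [Finset.mul_sum, Finset.mul_sum]
    refine Finset.sum_congr rfl fun q _ => ?_
    ring
  rw [← e]
  exact h

end AllPlaquettes


/-! ## §6 [4] Prop. 2 (53)–(54) and the p. 267 sentence before (44) ON THE TORUS for print's averaging -/

section Regularity

open scoped Matrix.Norms.L2Operator

variable {j : ℕ} {N : ℕ} [NeZero N]

/-- **[4] (53)–(54) AT LEVEL `j ≤ k` ON THE TORUS CARRIER FOR PRINT'S OWN AVERAGING, WITH THE PRINTED LOCALITY** ([4] p. 26: «If U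
satisfies (52) with α₀ ≦ c₂ … then |Ū^k(∂p) − 1| < α₀ + 2C₀α₀² < 2α₀ … The result is local in the sense that if p = ⟨x, y, z, w⟩, then
it is enough to assume (52) for p ⊂ B^k(x) ∪ B^k(y) ∪ B^k(z) ∪ B^k(w)»; the form B10 consumes at p. 267 and p. 273): for a `U(N)`-valued
`U` on `T_η` (`η = L^{−k}`), `p′` a plaquette of `T^{(j)}`, `j ≤ k`, `j ≤ m + K`, (52) as `dist1 (plaqHol U q) ≤ θ` on `deltaAllT j p′`
with `θ < α₀η²`, and `0 < α₀`, `C₀α₀ ≤ ⅓`, `2α₀ ≤ c₂′(d, L)`:  **`‖Ū^j(∂p′) − 1‖ < 2α₀(L^jη)²`** (`Ū^j = avgT j U`).  Proof = p29's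
`B10Eq44AvgRegularity.avg_level_lt_two_local` (the `ℤ^d` induction (53) with the clamped extension) for the pullback `U♯_{x₀}` at the
coarse plaquette `(0; μ, ν)`, transported by `pdevOn_pull_le` and `holT_avgT_plaqWord`. [cite: Balaban1985Averaging, Prop. 2 (52)–(54) p.26; Balaban1985UV3, p.267 (sentence before (44))] -/
theorem prop2_level_torus (hj : j ≤ P.m + P.K) {k : ℕ} (hjk : j ≤ k) (U : GaugeField P 0 (Matrix.unitaryGroup (Fin N) ℂ))
    (p : Plaq P j) {α₀ θ : ℝ} (hα : 0 < α₀) (hα3 : C0 P.d * α₀ ≤ 1 / 3) (hα2 : 2 * α₀ ≤ c2' P.d P.L)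
    (h52 : ∀ q ∈ deltaAllT j p, dist1 (GaugeField.plaqHol U q) ≤ θ)
    (hθ : θ < α₀ * (((P.L : ℝ) ^ k)⁻¹) ^ 2) :
    ‖((holT (avgT j U) p.src (plaqWord p.μ p.ν) : (Matrix (Fin N) (Fin N) ℂ)ˣ) : Matrix (Fin N) (Fin N) ℂ) - 1‖ <
      2 * α₀ * ((P.L : ℝ) ^ j * ((P.L : ℝ) ^ k)⁻¹) ^ 2 := by
  letI : CStarAlgebra (Matrix (Fin N) (Fin N) ℂ) := B10Eq29TubeLine.cstarAlgebraMatrix N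
  have hL : 2 ≤ P.L := P.hL.2
  have hL0 : (0 : ℝ) < P.L := by exact_mod_cast P.L_pos
  have hθ' : max θ 0 < α₀ * (((P.L : ℝ) ^ k)⁻¹) ^ 2 := max_lt hθ (by positivity)
  have hU : ∀ x κ, pull (unitsField U) (fine P j p.src) x κ ∈ unitaryUnits (Matrix (Fin N) (Fin N) ℂ) :=
    fun x κ => unitsField_mem_unitaryUnits U _
  have h52' : pdevOn (loK P.L j 0) (plaqHiK P.L j 0 p.μ p.ν) (pull (unitsField U) (fine P j p.src)) <
      α₀ * (((P.L : ℝ) ^ k)⁻¹) ^ 2 :=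
    (pdevOn_pull_le hj U p (le_max_right θ 0) (fun q hq => (h52 q hq).trans (le_max_left _ _))).trans_lt hθ'
  have h := B10Eq44AvgRegularity.avg_level_lt_two_local P.L hL (avgClosed_unitaryUnits P.d P.L) k
    (pull (unitsField U) (fine P j p.src)) hU hα hα3 hα2 hjk (0 : LSite P.d) p.μ p.ν h52'
  rw [← holT_avgT_plaqWord hj U p.src p.μ p.ν] at h
  exact h

/-- **[Balaban1985UV3] p. 267, THE SENTENCE BEFORE (44), ON THE TORUS CARRIER FOR PRINT'S OWN AVERAGING** («The configuration U_k
satisfies the following regularity condition on Ω_k: |U_k(∂p) − 1| < 2L²B₃g_{k−1}p(g_{k−1})η². This implies the condition |Ū_k^j(∂p′) − 1|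
< 4L²B₃g_{k−1}p(g_{k−1})(L^jη)² for p′ ⊂ Ω_k^{(j)}»; `ε` = the number `g_{k−1}p(g_{k−1})`): regularity `dist1 (plaqHol U_k q) ≤ θ`,
`θ < 2L²B₃εη²`, on the fine plaquettes of the four `j`-blocks at the corners of `p′` (`deltaAllT`; they lie in `Ω_k` for `p′ ⊂ Ω_k^{(j)}`,
`Ω_k` a union of blocks (39)), with [4] Prop. 2's smallness for `α₀ = 2L²B₃ε` explicit ⟹ **`‖Ū_k^j(∂p′) − 1‖ < 4L²B₃ε(L^jη)²`**, `j ≤ k`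
— p29's `B10Eq44AvgRegularity.reg44_avg_unitaryGroup` (`ℤ^d`, printed locality) BY NAME for the pullback, transported as above; a
member of row B10.Eq44 on the carrier of record. [cite: Balaban1985UV3, p.267 (sentence before (44)); Balaban1985Averaging, Prop. 2 (54) p.26] -/
theorem reg44_avg_torus (hj : j ≤ P.m + P.K) {k : ℕ} (hjk : j ≤ k) (U : GaugeField P 0 (Matrix.unitaryGroup (Fin N) ℂ))
    (p : Plaq P j) {B₃ ε θ : ℝ} (hpos : 0 < (P.L : ℝ) ^ 2 * B₃ * ε)
    (hα3 : C0 P.d * (2 * (P.L : ℝ) ^ 2 * B₃ * ε) ≤ 1 / 3) (hα2 : 2 * (2 * (P.L : ℝ) ^ 2 * B₃ * ε) ≤ c2' P.d P.L)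
    (hreg : ∀ q ∈ deltaAllT j p, dist1 (GaugeField.plaqHol U q) ≤ θ)
    (hθ : θ < 2 * (P.L : ℝ) ^ 2 * B₃ * ε * (((P.L : ℝ) ^ k)⁻¹) ^ 2) :
    ‖((holT (avgT j U) p.src (plaqWord p.μ p.ν) : (Matrix (Fin N) (Fin N) ℂ)ˣ) : Matrix (Fin N) (Fin N) ℂ) - 1‖ <
      4 * (P.L : ℝ) ^ 2 * B₃ * ε * ((P.L : ℝ) ^ j * ((P.L : ℝ) ^ k)⁻¹) ^ 2 := by
  letI : CStarAlgebra (Matrix (Fin N) (Fin N) ℂ) := B10Eq29TubeLine.cstarAlgebraMatrix N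
  have hL : 2 ≤ P.L := P.hL.2
  have hL0 : (0 : ℝ) < P.L := by exact_mod_cast P.L_pos
  have hθ' : max θ 0 < 2 * (P.L : ℝ) ^ 2 * B₃ * ε * (((P.L : ℝ) ^ k)⁻¹) ^ 2 :=
    max_lt hθ (mul_pos (by linarith) (by positivity))
  have hU : ∀ x κ, pull (unitsField U) (fine P j p.src) x κ ∈ unitaryUnits (Matrix (Fin N) (Fin N) ℂ) :=
    fun x κ => unitsField_mem_unitaryUnits U _
  have hreg' : pdevOn (loK P.L j 0) (plaqHiK P.L j 0 p.μ p.ν) (pull (unitsField U) (fine P j p.src)) <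
      2 * (P.L : ℝ) ^ 2 * B₃ * ε * (((P.L : ℝ) ^ k)⁻¹) ^ 2 :=
    (pdevOn_pull_le hj U p (le_max_right θ 0) (fun q hq => (hreg q hq).trans (le_max_left _ _))).trans_lt hθ'
  have h := B10Eq44AvgRegularity.reg44_avg_unitaryGroup N P.L hL k (pull (unitsField U) (fine P j p.src)) hU hpos hα3 hα2
    hjk (0 : LSite P.d) p.μ p.ν hreg'
  rw [← holT_avgT_plaqWord hj U p.src p.μ p.ν] at h
  exact h

/-- The same sentence for the semi-simple model `SU(N)` of Theorem 1 (`Ū_k^j = avgT j (toUField U)`; `dist1` of the cell's `SU(N)` instance).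
[cite: Balaban1985UV3, p.267 (sentence before (44)), Thm 1 p.257] -/
theorem reg44_avg_torus_specialUnitaryGroup (hj : j ≤ P.m + P.K) {k : ℕ} (hjk : j ≤ k)
    (U : GaugeField P 0 (Matrix.specialUnitaryGroup (Fin N) ℂ))
    (p : Plaq P j) {B₃ ε θ : ℝ} (hpos : 0 < (P.L : ℝ) ^ 2 * B₃ * ε)
    (hα3 : C0 P.d * (2 * (P.L : ℝ) ^ 2 * B₃ * ε) ≤ 1 / 3) (hα2 : 2 * (2 * (P.L : ℝ) ^ 2 * B₃ * ε) ≤ c2' P.d P.L)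
    (hreg : ∀ q ∈ deltaAllT j p, dist1 (GaugeField.plaqHol U q) ≤ θ)
    (hθ : θ < 2 * (P.L : ℝ) ^ 2 * B₃ * ε * (((P.L : ℝ) ^ k)⁻¹) ^ 2) :
    ‖((holT (avgT j (toUField U)) p.src (plaqWord p.μ p.ν) : (Matrix (Fin N) (Fin N) ℂ)ˣ) : Matrix (Fin N) (Fin N) ℂ) - 1‖ <
      4 * (P.L : ℝ) ^ 2 * B₃ * ε * ((P.L : ℝ) ^ j * ((P.L : ℝ) ^ k)⁻¹) ^ 2 :=
  reg44_avg_torus hj hjk (toUField U) p hpos hα3 hα2 (fun q hq => by rw [dist1_plaqHol_toUField]; exact hreg q hq) hθ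

end Regularity

end Literature.MathematicalPhysics.QuantumFieldTheory.Balaban1983to89.B10Eq69TorusPullback

end
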